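import Summits.CriticalPhenomena.PercolationContinuityZ3.Theorems.PercNearOneGluingAdditiveGluingPairStepOdds
import Summits.CriticalPhenomena.PercolationContinuityZ3.Theorems.PercNearOneGluingAdditiveGluingGoodStep24Glue

/-! # Crux `PercNearOneGluing.AdditiveGluing` (stmt-CriticalPhenomena-4576), line `peel`, stub `stub_ratioMonotonePair` —
# the master inequality G: wins dominate every antitone losing-side functional (any relay set)

Support file (`--supports stmt-CriticalPhenomena-4576`, registered stub `stub_winsDominatePockets_v22786`); no definitions, no named
facts.  Theorems-side copy of the middle part of the crux workfile `Cruxes/AdditiveGluing/RatioOneRelay.lean` (control-strategist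
seat g2, sorry-free; names `winsDominate*` ↦ `pairStep_winsDominate*`, `ratioZeta_*` ↦ `pairStep_zeta_*`).

`μ = prodBernoulli w`; `a` the designated relay, `s` the observer, `v` a bystander, `b` the target; `WIN(X) = μ(X ↔ b, a ↮ X)`.
* `pairStep_winsDominate_hijack_le` / `pairStep_winsDominate` (**G**): for any antitone `η ≥ 0` on vertex sets vanishing on sets
  containing `a`, `WIN(S)·E[η(C(s))] ≥ WIN(s)·E[η(C(S))]` for `S = {s, v}` (BHK 2006 Thm 1.3 with `1{v ∈ C_a}` against `1{b ∈ C_a}`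
  given `a ↮ s`, and Thm 1.4 with `1{v ∈ C_a}` against `η(V(C_s))`).
* `pairStep_winsDominate_pockets` (**pockets drop at least as fast as wins**, the penalty-free part `M₁ ≥ 0` of the pair step for
  EVERY relay set `A`): `WIN(s)·Z(S) ≤ WIN(S)·Z(s)` with `Z` the dead-pocket mass with worst selection (`Finset.inf'` product form) —
  instance `η = ζ_A` (`pairStep_zeta_antitone`).  What remains of `stub_ratioMonotonePair` after it is the penalty comparison
  `LOSE(s)·P(S) − LOSE(S)·P(s) ≤ WIN(S)·Z(s) − WIN(s)·Z(S)` (`P = LOSE − Z`, live-other + re-ordering loss).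
[cite: VandenbergHaggstromKahn2005, Thm. 1.3 (p. 6), Thm. 1.4 (p. 7); KozmaNitzan2024, Lemma 1 (pp. 5–6), §3.2 pp. 12–14]
-/

namespace Summit.CriticalPhenomena.PercolationContinuityZ3.Theorems

open MeasureTheory Set
open Literature.Probability.LatticeModels (prodBernoulli)
open Literature.Probability.Percolation

noncomputable section
open Classical

section PairStepWinsDominate

variable {n : ℕ}

/-- Off `{a ↮ s}` an `a`-vanishing function of the cluster of `s` vanishes, so its set integral over `{a ↮ s} ∩ E` is its
set integral over `E`. [folklore] -/
theorem pairStep_winsDominate_setIntegral_inter_eq (w : Sym2 (Fin n) → unitInterval) (a s : Fin n) (η : Finset (Fin n) → ℝ)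
    (hηa : ∀ T : Finset (Fin n), a ∈ T → η T = 0) (E : Set (BondConfig (Fin n))) :
    ∫ ω in (openConn a s : Set (BondConfig (Fin n)))ᶜ ∩ E,
        η (Finset.univ.filter fun x : Fin n => x ∈ openCluster ω s) ∂(prodBernoulli w) =
      ∫ ω in E, η (Finset.univ.filter fun x : Fin n => x ∈ openCluster ω s) ∂(prodBernoulli w) := by
  rw [← integral_indicator (MeasurableSet.of_discrete), ← integral_indicator (MeasurableSet.of_discrete)]
  refine integral_congr_ae (Filter.Eventually.of_forall fun ω => ?_)
  by_cases hE : ω ∈ E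
  · by_cases hD : ω ∈ (openConn a s : Set (BondConfig (Fin n)))ᶜ
    · rw [Set.indicator_of_mem (Set.mem_inter hD hE), Set.indicator_of_mem hE]
    · rw [Set.indicator_of_notMem (fun h => hD h.1), Set.indicator_of_mem hE]
      refine (hηa _ ?_).symm
      simp only [Finset.mem_filter, Finset.mem_univ, true_and]
      have h : (openGraph ω).Reachable a s := not_not.1 hD
      exact h.symm
  · rw [Set.indicator_of_notMem (fun h => hE h.2), Set.indicator_of_notMem hE]

/-- **Wins dominate the losing side, point form (the exchange lemma behind ratio monotonicity).**  For vertices `a ≠ s`, a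
bystander `v`, the target `b`, and ANY antitone `η ≥ 0` on vertex sets vanishing on sets containing `a`:
`μ(s↔b, a↮s, v↔a) · E[η(C(s))] ≤ μ(s↔b, a↮s) · E[η(C(s)); v↔a]` — "given that `s` beats `a`, the bystander is hijacked by `a` at most
as often as it is in any `η`-weighted losing configuration".  Proof: BHK 1.4 (`1{b ∈ C_s}` vs `1{v ∈ C_a}` given `s ↮ a`) and BHK's two-cluster
theorem (`1{v ∈ C_a}` increasing in `C_a`, `η(V(C_s))` antitone in `C_s`, given `a ↮ s`), chained through `P(v ↔ a | a ↮ s)`.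
[cite: VandenbergHaggstromKahn2005, Thm. 1.4–1.5 (p. 7); KozmaNitzan2024, Lemma 1 (pp. 5–6)] -/
theorem pairStep_winsDominate_hijack_le (w : Sym2 (Fin n) → unitInterval) (a s v b : Fin n) (has : a ≠ s)
    (η : Finset (Fin n) → ℝ) (hη : Antitone η) (hη0 : ∀ T, 0 ≤ η T) (hηa : ∀ T : Finset (Fin n), a ∈ T → η T = 0) :
    (prodBernoulli w).real ((openConn a s)ᶜ ∩ openConn s b ∩ openConn a v)
        * ∫ ω, η (Finset.univ.filter fun x : Fin n => x ∈ openCluster ω s) ∂(prodBernoulli w) ≤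
      (prodBernoulli w).real ((openConn a s)ᶜ ∩ openConn s b)
        * ∫ ω in (openConn a v : Set (BondConfig (Fin n))),
            η (Finset.univ.filter fun x : Fin n => x ∈ openCluster ω s) ∂(prodBernoulli w) := by
  have hD1 : {ω : BondConfig (Fin n) | ¬ (openGraph ω).Reachable s a} =
      (openConn a s : Set (BondConfig (Fin n)))ᶜ := by
    ext ω
    simp only [Set.mem_setOf_eq, Set.mem_compl_iff]
    rw [show (ω ∈ openConn a s ↔ (openGraph ω).Reachable a s) from Iff.rfl]
    exact ⟨fun h h' => h h'.symm, fun h h' => h h'.symm⟩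
  have hD2 : {ω : BondConfig (Fin n) | ¬ (openGraph ω).Reachable a s} =
      (openConn a s : Set (BondConfig (Fin n)))ᶜ := rfl
  set D : Set (BondConfig (Fin n)) := (openConn a s)ᶜ with hD
  -- (1) BHK Thm 1.4: `1{b ∈ C_s}` and `1{v ∈ C_a}` are negatively correlated given `{s ↮ a}`
  have hB := BHK2006_twoClusterConditionalAssociation_holds.negCorrelation (Fin n) w s a
    (fun C => if (b = s ∨ ∃ e ∈ C, b ∈ e) then (1 : ℝ) else 0)
    (fun C => if (v = a ∨ ∃ e ∈ C, v ∈ e) then (1 : ℝ) else 0)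
    (pairStep_hit_mono s b) (pairStep_hit_mono a v) (Ne.symm has)
  rw [hD1] at hB
  simp only [pairStep_hit_apply] at hB
  rw [pairStep_setIntegral_indicator, pairStep_setIntegral_indicator,
    pairStep_setIntegral_indicator_mul] at hB
  -- (2) BHK two-cluster theorem for the pair `(a, s)`: `1{v ∈ C_a}` (increasing in `C_a`) and `η(V(C_s))` (antitone in `C_s`)
  have hT := BHK2006_twoClusterConditionalAssociation_holds (Fin n) w a s
    (fun C _ => if (v = a ∨ ∃ e ∈ C, v ∈ e) then (1 : ℝ) else 0)
    (fun _ C' => η (Finset.univ.filter fun x : Fin n => x = s ∨ ∃ e ∈ C', x ∈ e))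
    (fun _ => pairStep_hit_mono a v) (fun _ => antitone_const)
    (fun _ => monotone_const) (fun _ => hη.comp_monotone (offObs_vertF_mono s)) has
  rw [hD2] at hT
  simp only [pairStep_hit_apply, offObs_vertF_openEdgeCluster] at hT
  rw [pairStep_setIntegral_indicator] at hT
  -- the `η`-integrals over `D` are the full integrals (η vanishes off `D`)
  have hI1 : ∫ ω in D, η (Finset.univ.filter fun x : Fin n => x ∈ openCluster ω s) ∂(prodBernoulli w) =
      ∫ ω, η (Finset.univ.filter fun x : Fin n => x ∈ openCluster ω s) ∂(prodBernoulli w) := by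
    have h := pairStep_winsDominate_setIntegral_inter_eq w a s η hηa Set.univ
    rwa [Set.inter_univ, Measure.restrict_univ] at h
  have hI2 : ∫ ω in D, (openConn a v : Set (BondConfig (Fin n))).indicator 1 ω *
        η (Finset.univ.filter fun x : Fin n => x ∈ openCluster ω s) ∂(prodBernoulli w) =
      ∫ ω in (openConn a v : Set (BondConfig (Fin n))),
        η (Finset.univ.filter fun x : Fin n => x ∈ openCluster ω s) ∂(prodBernoulli w) := by
    have h := pairStep_winsDominate_setIntegral_inter_eq w a s η hηa (openConn a v)
    rw [← hD] at h
    have hprod : (fun ω : BondConfig (Fin n) => (openConn a v : Set (BondConfig (Fin n))).indicator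
        (1 : BondConfig (Fin n) → ℝ) ω * η (Finset.univ.filter fun x : Fin n => x ∈ openCluster ω s)) =
        (openConn a v : Set (BondConfig (Fin n))).indicator
          (fun ω => η (Finset.univ.filter fun x : Fin n => x ∈ openCluster ω s)) := by
      funext ω
      by_cases hω : ω ∈ (openConn a v : Set (BondConfig (Fin n)))
      · rw [Set.indicator_of_mem hω, Set.indicator_of_mem hω, Pi.one_apply, one_mul]
      · rw [Set.indicator_of_notMem hω, Set.indicator_of_notMem hω, zero_mul]
    rw [hprod, integral_indicator (MeasurableSet.of_discrete), Measure.restrict_restrict (MeasurableSet.of_discrete),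
      Set.inter_comm, h]
  rw [hI1, hI2] at hT
  -- names and signs
  set d := (prodBernoulli w).real D with hd
  set Sb := (prodBernoulli w).real (D ∩ openConn s b) with hSb
  set Av := (prodBernoulli w).real (D ∩ openConn a v) with hAv
  set H := (prodBernoulli w).real (D ∩ openConn s b ∩ openConn a v) with hH
  set I := ∫ ω, η (Finset.univ.filter fun x : Fin n => x ∈ openCluster ω s) ∂(prodBernoulli w) with hI
  set J := ∫ ω in (openConn a v : Set (BondConfig (Fin n))),
      η (Finset.univ.filter fun x : Fin n => x ∈ openCluster ω s) ∂(prodBernoulli w) with hJ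
  have hI0 : 0 ≤ I := integral_nonneg fun ω => hη0 _
  have hJ0 : 0 ≤ J := setIntegral_nonneg (MeasurableSet.of_discrete) fun ω _ => hη0 _
  have hSb0 : 0 ≤ Sb := measureReal_nonneg
  have hH0 : 0 ≤ H := measureReal_nonneg
  have hHle : H ≤ d := measureReal_mono (Set.inter_subset_left.trans Set.inter_subset_left) (measure_ne_top _ _)
  -- hB : d * H ≤ Sb * Av ;  hT : Av * I ≤ d * J
  have h1 : d * (H * I) ≤ Sb * (Av * I) := by
    have := mul_le_mul_of_nonneg_right hB hI0
    linarith
  have h2 : Sb * (Av * I) ≤ d * (Sb * J) := by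
    have := mul_le_mul_of_nonneg_left hT hSb0
    linarith
  by_cases hd0 : d = 0
  · have hH' : H = 0 := le_antisymm (hd0 ▸ hHle) hH0
    rw [hH', zero_mul]
    exact mul_nonneg hSb0 hJ0
  · have hdpos : 0 < d := lt_of_le_of_ne measureReal_nonneg (Ne.symm hd0)
    exact le_of_mul_le_mul_left (h1.trans h2) hdpos

/-- **Wins dominate the losing side (master inequality G, one bystander).**  For `a ≠ s`, `S = {s, v}`, and any antitone `η ≥ 0` on vertex
sets vanishing on sets containing `a`:  `WIN(S) · E[η(C(s))] ≥ WIN(s) · E[η(C(S))]`, where `WIN(X) = μ(X ↔ b, a ↮ X)` and `C(S) = C(s) ∪ C(v)`.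
Instances: `η(W) = 1{b ∉ W} μ(a ↔ b in Wᶜ)` gives the one-relay ratio monotonicity `pairStep_odds`; `η(W) = 1{W ∩ A = ∅}·min_A μ(· ↔ b in Wᶜ)`
gives `WIN(S)·Z(s) ≥ WIN(s)·Z(S)` (pockets drop at least as fast as wins) for the line's dead-pocket mass `Z`.
[cite: VandenbergHaggstromKahn2005, Thm. 1.4–1.5 (p. 7); KozmaNitzan2024, Lemma 1 (pp. 5–6), §3.2 pp. 12–14] -/
theorem pairStep_winsDominate (w : Sym2 (Fin n) → unitInterval) (a s v b : Fin n) (has : a ≠ s)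
    (η : Finset (Fin n) → ℝ) (hη : Antitone η) (hη0 : ∀ T, 0 ≤ η T) (hηa : ∀ T : Finset (Fin n), a ∈ T → η T = 0) :
    (prodBernoulli w).real (openConn s b ∩ (openConn a s)ᶜ)
        * ∫ ω, η (Finset.univ.filter fun x : Fin n => x ∈ openCluster ω s ∨ x ∈ openCluster ω v) ∂(prodBernoulli w) ≤
      (prodBernoulli w).real ((openConn s b ∪ openConn v b) ∩ (openConn a s)ᶜ ∩ (openConn a v)ᶜ)
        * ∫ ω, η (Finset.univ.filter fun x : Fin n => x ∈ openCluster ω s) ∂(prodBernoulli w) := by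
  have key := pairStep_winsDominate_hijack_le w a s v b has η hη hη0 hηa
  -- WIN(S) ≥ WIN(s) − Hij
  have hWIN : (prodBernoulli w).real (openConn s b ∩ (openConn a s)ᶜ) ≤
      (prodBernoulli w).real ((openConn s b ∪ openConn v b) ∩ (openConn a s)ᶜ ∩ (openConn a v)ᶜ)
        + (prodBernoulli w).real ((openConn a s)ᶜ ∩ openConn s b ∩ openConn a v) := by
    have hsub : (openConn s b : Set (BondConfig (Fin n))) ∩ (openConn a s)ᶜ ⊆
        ((openConn s b ∪ openConn v b) ∩ (openConn a s)ᶜ ∩ (openConn a v)ᶜ) ∪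
          ((openConn a s)ᶜ ∩ openConn s b ∩ openConn a v) := by
      rintro ω ⟨hsb, has'⟩
      by_cases hav : ω ∈ (openConn a v : Set (BondConfig (Fin n)))
      · exact Or.inr ⟨⟨has', hsb⟩, hav⟩
      · exact Or.inl ⟨⟨Or.inl hsb, has'⟩, hav⟩
    exact (measureReal_mono hsub (measure_ne_top _ _)).trans (measureReal_union_le _ _)
  -- E[η(C(S))] ≤ E[η(C(s))] − E[η(C(s)); v↔a]
  have hpt : ∀ ω : BondConfig (Fin n),
      η (Finset.univ.filter fun x : Fin n => x ∈ openCluster ω s ∨ x ∈ openCluster ω v) ≤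
        η (Finset.univ.filter fun x : Fin n => x ∈ openCluster ω s)
          - (openConn a v : Set (BondConfig (Fin n))).indicator
              (fun ω => η (Finset.univ.filter fun x : Fin n => x ∈ openCluster ω s)) ω := by
    intro ω
    by_cases hav : ω ∈ (openConn a v : Set (BondConfig (Fin n)))
    · rw [Set.indicator_of_mem hav, sub_self]
      refine le_of_eq (hηa _ ?_)
      simp only [Finset.mem_filter, Finset.mem_univ, true_and]
      exact Or.inr (show (openGraph ω).Reachable v a from (SimpleGraph.Reachable.symm hav))
    · rw [Set.indicator_of_notMem hav, sub_zero]
      refine hη ?_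
      intro x hx
      simp only [Finset.mem_filter, Finset.mem_univ, true_and] at hx ⊢
      exact Or.inl hx
  have hint : ∫ ω, η (Finset.univ.filter fun x : Fin n => x ∈ openCluster ω s ∨ x ∈ openCluster ω v) ∂(prodBernoulli w) ≤
      ∫ ω, η (Finset.univ.filter fun x : Fin n => x ∈ openCluster ω s) ∂(prodBernoulli w)
        - ∫ ω in (openConn a v : Set (BondConfig (Fin n))),
            η (Finset.univ.filter fun x : Fin n => x ∈ openCluster ω s) ∂(prodBernoulli w) := by
    rw [← integral_indicator (MeasurableSet.of_discrete), ← integral_sub (Integrable.of_finite) (Integrable.of_finite)]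
    exact integral_mono (Integrable.of_finite) (Integrable.of_finite) hpt
  have hWs0 : 0 ≤ (prodBernoulli w).real (openConn s b ∩ (openConn a s)ᶜ) := measureReal_nonneg
  have hI0 : 0 ≤ ∫ ω, η (Finset.univ.filter fun x : Fin n => x ∈ openCluster ω s) ∂(prodBernoulli w) :=
    integral_nonneg fun ω => hη0 _
  have hIS0 : 0 ≤ ∫ ω, η (Finset.univ.filter fun x : Fin n => x ∈ openCluster ω s ∨ x ∈ openCluster ω v) ∂(prodBernoulli w) :=
    integral_nonneg fun ω => hη0 _
  have hcomm : (prodBernoulli w).real ((openConn a s)ᶜ ∩ openConn s b) =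
      (prodBernoulli w).real (openConn s b ∩ (openConn a s)ᶜ) := by
    rw [Set.inter_comm]
  rw [hcomm] at key
  nlinarith [key, hWIN, hint, hWs0, hI0, hIS0, mul_le_mul_of_nonneg_left hint hWs0]

/-! ### Corollary for the line's dead-pocket mass: `WIN(S)·Z(s) ≥ WIN(s)·Z(S)` -/

/-- Finite-sum form of the integral of a function of a `Finset`-valued statistic. [folklore] -/
theorem pairStep_zeta_integral_eq_sum (w : Sym2 (Fin n) → unitInterval) (g : BondConfig (Fin n) → Finset (Fin n))
    (φ : Finset (Fin n) → ℝ) :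
    ∫ ω, φ (g ω) ∂(prodBernoulli w) = ∑ T : Finset (Fin n), φ T * (prodBernoulli w).real {ω : BondConfig (Fin n) | g ω = T} := by
  have hpt : ∀ ω : BondConfig (Fin n), φ (g ω) =
      ∑ T : Finset (Fin n), ({ω : BondConfig (Fin n) | g ω = T}).indicator (fun _ => φ T) ω := by
    intro ω
    rw [Finset.sum_eq_single (g ω)]
    · rw [Set.indicator_of_mem (show ω ∈ {ω' : BondConfig (Fin n) | g ω' = g ω} from rfl)]
    · intro T _ hT
      rw [Set.indicator_of_notMem]
      exact fun h => hT (Eq.symm h)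
    · exact fun h => absurd (Finset.mem_univ _) h
  simp_rw [hpt]
  rw [integral_finsetSum]
  · refine Finset.sum_congr rfl fun T _ => ?_
    rw [integral_indicator MeasurableSet.of_discrete, setIntegral_const, smul_eq_mul, mul_comm]
  · intro T _
    exact (integrable_const _).indicator MeasurableSet.of_discrete

/-- The line's pocket functional `ζ(T) = 1{T ∩ A = ∅} · min_{a ∈ A} μ(a ↔ b in Tᶜ)` is antitone in `T`. [folklore] -/
theorem pairStep_zeta_antitone (w : Sym2 (Fin n) → unitInterval) (A : Finset (Fin n)) (b : Fin n) (hb : b ∈ A) :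
    Antitone (fun T : Finset (Fin n) => if Disjoint T A then
      A.inf' ⟨b, hb⟩ (fun a => (prodBernoulli w).real (openConnIn ((T : Set (Fin n)))ᶜ a b)) else 0) := by
  intro T T' hTT'
  have hnn : ∀ U : Finset (Fin n), 0 ≤ A.inf' ⟨b, hb⟩
      (fun a => (prodBernoulli w).real (openConnIn ((U : Set (Fin n)))ᶜ a b)) :=
    fun U => Finset.le_inf' _ _ fun a _ => measureReal_nonneg
  by_cases hd' : Disjoint T' A
  · have hd : Disjoint T A := Finset.disjoint_of_subset_left hTT' hd'
    simp only [hd, hd', if_true]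
    refine Finset.le_inf' _ _ fun a ha => (Finset.inf'_le _ ha).trans ?_
    refine measureReal_mono (goodStep24_openConnIn_mono ?_ a b) (measure_ne_top _ _)
    exact Set.compl_subset_compl.2 (Finset.coe_subset.2 hTT')
  · simp only [hd', if_false]
    split_ifs
    · exact hnn T
    · exact le_refl _

/-- The block-cluster event of the line's stubs, for the block `{s, v}`, is the fibre of the `Finset` statistic
`ω ↦ {x | x ∈ C(s) ∨ x ∈ C(v)}`. [folklore] -/
theorem pairStep_zeta_blockEvent_eq (s v : Fin n) (T : Finset (Fin n)) :
    {ω : BondConfig (Fin n) | ∀ z : Fin n, (z ∈ T ↔ ω ∈ ⋃ x ∈ ({s, v} : Finset (Fin n)), openConn x z)} =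
      {ω : BondConfig (Fin n) | (Finset.univ.filter fun x : Fin n => x ∈ openCluster ω s ∨ x ∈ openCluster ω v) = T} := by
  ext ω
  simp only [Set.mem_setOf_eq]
  constructor
  · intro h
    ext z
    simp only [Finset.mem_filter, Finset.mem_univ, true_and]
    rw [h z]
    simp only [Set.mem_iUnion, Finset.mem_insert, Finset.mem_singleton, exists_prop]
    constructor
    · rintro (hz | hz)
      · exact ⟨s, Or.inl rfl, hz⟩
      · exact ⟨v, Or.inr rfl, hz⟩
    · rintro ⟨x, (hx | hx), hz⟩
      · subst hx; exact Or.inl hz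
      · subst hx; exact Or.inr hz
  · intro h z
    rw [← h]
    simp only [Finset.mem_filter, Finset.mem_univ, true_and, Set.mem_iUnion, Finset.mem_insert, Finset.mem_singleton,
      exists_prop]
    constructor
    · rintro (hz | hz)
      · exact ⟨s, Or.inl rfl, hz⟩
      · exact ⟨v, Or.inr rfl, hz⟩
    · rintro ⟨x, (hx | hx), hz⟩
      · subst hx; exact Or.inl hz
      · subst hx; exact Or.inr hz

/-- **Pockets drop at least as fast as wins** (`Λ(ζ) ≥ 0`), in the syntax of the line's stubs for the block `S = {s, v}`:
`WIN(s) · Z(S) ≤ WIN(S) · Z(s)` with `Z` the dead-pocket mass with worst selection (`Finset.inf'` product form) and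
`WIN(X) = μ(X ↔ b, a₀ ↮ X)`.  Instance `η = ζ` of `pairStep_winsDominate`. [cite: VandenbergHaggstromKahn2005, Thm. 1.4–1.5 (p. 7); KozmaNitzan2024, §3.2 pp. 12–14] -/
theorem pairStep_winsDominate_pockets (w : Sym2 (Fin n) → unitInterval) (A : Finset (Fin n)) (b a₀ s v : Fin n)
    (hb : b ∈ A) (ha₀ : a₀ ∈ A) (has : a₀ ≠ s) :
    (prodBernoulli w).real (openConn s b ∩ (openConn a₀ s)ᶜ)
        * (∑ W ∈ (Finset.univ : Finset (Finset (Fin n))).filter (fun W => Disjoint W A),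
            (prodBernoulli w).real
                {ω : BondConfig (Fin n) | ∀ z : Fin n, (z ∈ W ↔ ω ∈ ⋃ x ∈ ({s, v} : Finset (Fin n)), openConn x z)}
              * A.inf' ⟨b, hb⟩ (fun a => (prodBernoulli w).real (openConnIn ((W : Set (Fin n)))ᶜ a b))) ≤
      (prodBernoulli w).real ((openConn s b ∪ openConn v b) ∩ (openConn a₀ s)ᶜ ∩ (openConn a₀ v)ᶜ)
        * (∑ W ∈ (Finset.univ : Finset (Finset (Fin n))).filter (fun W => s ∈ W ∧ Disjoint W A),
            (prodBernoulli w).real {ω : BondConfig (Fin n) | openCluster ω s = (W : Set (Fin n))}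
              * A.inf' ⟨b, hb⟩ (fun a => (prodBernoulli w).real (openConnIn ((W : Set (Fin n)))ᶜ a b))) := by
  set ζ : Finset (Fin n) → ℝ := fun T => if Disjoint T A then
      A.inf' ⟨b, hb⟩ (fun a => (prodBernoulli w).real (openConnIn ((T : Set (Fin n)))ᶜ a b)) else 0 with hζ
  have hnn : ∀ U : Finset (Fin n), 0 ≤ A.inf' ⟨b, hb⟩
      (fun a => (prodBernoulli w).real (openConnIn ((U : Set (Fin n)))ᶜ a b)) :=
    fun U => Finset.le_inf' _ _ fun a _ => measureReal_nonneg
  have hζ0 : ∀ T, 0 ≤ ζ T := fun T => by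
    simp only [hζ]
    split_ifs
    · exact hnn T
    · exact le_refl _
  have hζa : ∀ T : Finset (Fin n), a₀ ∈ T → ζ T = 0 := fun T hT => by
    simp only [hζ]
    rw [if_neg]
    exact fun hd => Finset.disjoint_left.1 hd hT ha₀
  have key := pairStep_winsDominate w a₀ s v b has ζ (pairStep_zeta_antitone w A b hb) hζ0 hζa
  -- the two integrals as the sums of the statement
  have hS : ∫ ω, ζ (Finset.univ.filter fun x : Fin n => x ∈ openCluster ω s ∨ x ∈ openCluster ω v) ∂(prodBernoulli w) =
      ∑ W ∈ (Finset.univ : Finset (Finset (Fin n))).filter (fun W => Disjoint W A),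
        (prodBernoulli w).real
            {ω : BondConfig (Fin n) | ∀ z : Fin n, (z ∈ W ↔ ω ∈ ⋃ x ∈ ({s, v} : Finset (Fin n)), openConn x z)}
          * A.inf' ⟨b, hb⟩ (fun a => (prodBernoulli w).real (openConnIn ((W : Set (Fin n)))ᶜ a b)) := by
    rw [pairStep_zeta_integral_eq_sum, Finset.sum_filter]
    refine Finset.sum_congr rfl fun T _ => ?_
    rw [pairStep_zeta_blockEvent_eq]
    simp only [hζ]
    split_ifs
    · ring
    · rw [zero_mul]
  have hs : ∫ ω, ζ (Finset.univ.filter fun x : Fin n => x ∈ openCluster ω s) ∂(prodBernoulli w) =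
      ∑ W ∈ (Finset.univ : Finset (Finset (Fin n))).filter (fun W => s ∈ W ∧ Disjoint W A),
        (prodBernoulli w).real {ω : BondConfig (Fin n) | openCluster ω s = (W : Set (Fin n))}
          * A.inf' ⟨b, hb⟩ (fun a => (prodBernoulli w).real (openConnIn ((W : Set (Fin n)))ᶜ a b)) := by
    rw [pairStep_zeta_integral_eq_sum, Finset.sum_filter]
    refine Finset.sum_congr rfl fun T _ => ?_
    have hfib : {ω : BondConfig (Fin n) | (Finset.univ.filter fun x : Fin n => x ∈ openCluster ω s) = T} =
        {ω : BondConfig (Fin n) | openCluster ω s = (T : Set (Fin n))} := by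
      ext ω
      exact (offObs_mem_fib_iff s T ω).symm
    rw [hfib]
    by_cases hsT : s ∈ T
    · simp only [hζ, hsT, true_and]
      split_ifs
      · ring
      · rw [zero_mul]
    · have hempty : {ω : BondConfig (Fin n) | openCluster ω s = (T : Set (Fin n))} = ∅ := by
        ext ω
        simp only [Set.mem_setOf_eq, Set.mem_empty_iff_false, iff_false]
        intro h
        apply hsT
        rw [← Finset.mem_coe, ← h]
        exact (SimpleGraph.Reachable.refl s : (openGraph ω).Reachable s s)
      rw [hempty, measureReal_empty, mul_zero]
      simp only [hsT, false_and, if_false, zero_mul]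
  rw [hS, hs] at key
  exact key


/-- **Registered form** (`stub_winsDominatePockets_v22786`, `--supports stmt-CriticalPhenomena-4576`): pockets drop at least as fast
as wins, for every relay set, as a closed statement. [cite: VandenbergHaggstromKahn2005, Thm. 1.3 (p. 6), Thm. 1.4 (p. 7)] -/
theorem stub_winsDominatePockets_v22786 : ∀ (n : ℕ) (w : Sym2 (Fin n) → unitInterval) (A : Finset (Fin n)) (b a₀ s v : Fin n) (hb : b ∈ A), a₀ ∈ A → a₀ ≠ s → (Literature.Probability.LatticeModels.prodBernoulli w).real (Literature.Probability.Percolation.openConn s b ∩ (Literature.Probability.Percolation.openConn a₀ s)ᶜ) * (∑ W ∈ (Finset.univ : Finset (Finset (Fin n))).filter (fun W => Disjoint W A), (Literature.Probability.LatticeModels.prodBernoulli w).real {ω : Literature.Probability.Percolation.BondConfig (Fin n) | ∀ z : Fin n, (z ∈ W ↔ ω ∈ ⋃ x ∈ ({s, v} : Finset (Fin n)), Literature.Probability.Percolation.openConn x z)} * A.inf' ⟨b, hb⟩ (fun a => (Literature.Probability.LatticeModels.prodBernoulli w).real (Literature.Probability.Percolation.openConnIn ((W : Set (Fin n)))ᶜ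 a b))) ≤ (Literature.Probability.LatticeModels.prodBernoulli w).real ((Literature.Probability.Percolation.openConn s b ∪ Literature.Probability.Percolation.openConn v b) ∩ (Literature.Probability.Percolation.openConn a₀ s)ᶜ ∩ (Literature.Probability.Percolation.openConn a₀ v)ᶜ) * (∑ W ∈ (Finset.univ : Finset (Finset (Fin n))).filter (fun W => s ∈ W ∧ Disjoint W A), (Literature.Probability.LatticeModels.prodBernoulli w).real {ω : Literature.Probability.Percolation.BondConfig (Fin n) | Literature.Probability.Percolation.openCluster ω s = (W : Set (Fin n))} * A.inf' ⟨b, hb⟩ (fun a => (Literature.Probability.LatticeModels.prodBernoulli w).real (Literature.Probability.Percolation.openConnIn ((W : Set (Fin n)))ᶜ a b))) :=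
  fun _ w A b a₀ s v hb ha₀ has => pairStep_winsDominate_pockets w A b a₀ s v hb ha₀ has

end PairStepWinsDominate

end

end Summit.CriticalPhenomena.PercolationContinuityZ3.Theorems
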